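import Summits.QuantumFields.YangMills.Theorems.BalabanUVNodesK1V6Defs
import Summits.QuantumFields.YangMills.Theorems.BalabanUVNodesK1WindowKOfAnchor

/-!
# Crux K1⁷ — RUNS OF EVERY LENGTH `K` INSIDE ONE COUPLING WINDOW FROM K1⁷ v6's RUN ROW (i) ALONE (DEF-1's run-wise constant remainder `RunConstRemainder β b r γ₀`),
# with an explicit bare coupling under row (ii), the two-sided discrete face along in-window runs under rows (i)(ii)(iv), and (B) biting at EVERY level inside ONE window
# (flow side for every forward-generated construction; at NODE 00's Stage-13 datum `Node00.datumOfRecord₁₃SepCoPH F N θ h`)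

Cell `pub-ymgap`, YM-PLAN Track A (HUMAN RULING D-0062 ∕ D-0149, director-ym №197 ∕ №207), WIDTH SEAT `pub-ymgap-dag-n13-w4` (g5; the g4 CLAIM-1 ∕ INTENT-1 of this path, dag-lead
DEDUP-378 GO) on NODE n13 [Balaban1989LargeFieldII]; helper (`--supports`, count-neutral) for crux K1⁷ `StabilityBAtRecordR13SepCoPH` = stmt-QuantumFields-20542.  Eighth module of the
seat's window lineage (g0 `…K1WindowFirstStep` ∕ `…N13WindowAtRecord13SepCoPH` ∕ `…K2Line2FirstRungsAtScaleZero`; g2 `…K1WindowExactCriterion` ∕ `…K1WindowBite` ∕ `…K1WindowSharpness` ∕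
`…K2Line2RungsAllScales` ∕ `…K1WindowKOfAnchor`), now in K1⁷ **v6**'s RUN CURRENCY (plan g82 `D82-K1V6`, 03f66ac9cc89391f; tree mirror dag-n24-w1's `…K1V6Defs`).

THE POINT.  K1⁷ v6's registered stub 2″ `stub_runRows13PWS` asks, at some rung-1 witness `(θ, h, w)`, the RUN ROWS (i) `RunConstRemainder β_θ b r γ₀` (ym-nodeO DEF-1's letter,
`…K2NamedJetsRunRemAt` :92: `|β_{k+1}(g_0,…,g_k) − b_k| ≤ r` at every prefix of every solution of (0.20) staying in `]0, γ₀]`), (ii) `b_k ≤ B`, (iii) the match `B + r ≤ w.βup`, (iv) the run-wise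
partial-sum floor `−M`.  The END road of record (dag-n24-w1 p598782 `…K1EndOfNodes13PWSOfRunRemAt` §2) turns them into (B) AND the crux's `K ≥ 1` window (the window through this seat's
`K1WindowExactCriterion.window_of_frequently_beta_le` — ONE step, level `0`).  Here: ROW (i) ALONE (`b` ANY sequence — DEF-1 g5's located note: the right generality) already gives, at its
ONE level `γ₀`, IN-WINDOW RUNS OF EVERY LENGTH `K`: for every `γ ∈ ]0, γ₀]`, every torus exponent `m` and EVERY `K` an explicit bare coupling `g₀ ∈ ]0, γ]`
(`g₀⁻² = γ⁻² + Σ_{k<K} max(b_k + r, 0)`; under row (ii): `g₀⁻² = γ⁻² + K·max(B + r, 0)`) whose run `⟨K, m, g₀⟩` of any forward-generated construction stays in `]0, γ]` AND SOLVES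
(0.20) up to `K` (`RGEqH K β g`; under the dictionary `CurriesHBeta` also `Flow.SatisfiesRG K`), with the ladder `γ⁻² + Σ_{i≤k<K} max(b_k + r, 0) ≤ g_i⁻²`.  Proof: forward induction —
the prefix generated so far IS an in-window (0.20)-run, so row (i) bounds the NEXT β along it (no box letter, no continuity, no sign, no match, no (PS) floor is read).  This is the
`InInterval` half of [I] Thm 2 p. 259 (`DagBinding.EndpointExistence`'s prefix WITHOUT the endpoint `g_K = g`), UNIFORM IN `K` — whereas p598782 derives `K ≥ 1` only,
`…K1WindowKOfAnchor` (g2) gave each `K` its own window from K2⁷'s S2, and `…K1WindowSharpness` §3 (g2) ∕ dag-n24-a's `Node00.N24_window_allK_of_forwardGenerated` needed BOX bounds at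
the levels `k ≥ 1`.  Nearest tree neighbours at the shooting level (cited, not imported): `Gaps.EndRunwiseShooting.seed_of_upper` (box ceiling) and `Gaps.EndRunwiseCone.seed_of_coneBounds`
(two-sided running-cone bounds with `0 ≤ b`); the present ladder is their one-sided, per-level, run-wise analogue at the construction level, in DEF-1's currency.
Rows (i)(ii)(iv) give along EVERY in-window (0.20)-run the two-sided discrete face `g_i⁻² − (k − i)(B + r) ≤ g_k⁻² ≤ g_i⁻² + M` (`i ≤ k ≤ n`) — the rows' (0.31)-type content keyed at
the EARLIER coupling.  With (B) at the construction (`B16.EndStatementBPrinted`), the uniform window makes (B) BITE AT EVERY LEVEL `k ≤ K` on runs of EVERY length inside ONE window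
`]0, γ_B]` (the uniform twin of g2's `…K1WindowKOfAnchor.bitesK_of_endStatementBPrinted_of_windowK`, where each `K` had its own window).

WHAT THIS FILE PROVES (theorems only; 0 `def`, 0 `sorry`, standard axioms).
* §1 flow side (any `β : HBeta`; any `DagBinding.ForwardGenerated C β`): `runwiseCeiling_of_runConstRemainder` · `satisfiesRG_of_curries_of_rgEqH` (the dictionary's converse of
  `DagBinding.rgEqH_of_curries`) · ★ `ladder_of_forwardGenerated_of_runwiseCeiling` (per-level run-wise ceiling `u`) · ★★ `windowK_uniform_of_forwardGenerated_of_runwiseCeiling` ·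
  ★★ `windowK_uniform_of_forwardGenerated_of_runConstRemainder` (row (i) ALONE) · `inIntervalHalf_of_forwardGenerated_of_runConstRemainder` (`EndpointExistence`'s prefix shape without the
  endpoint) · `ladder_of_forwardGenerated_of_runConstRemainder_of_le` + `windowK_uniform_of_forwardGenerated_of_runConstRemainder_of_le` (rows (i)(ii): explicit `g₀`, linear ladder) ·
  `discreteFace_alongRun_of_runRows` (rows (i)(ii)(iv)).
* §2 any finite-ε datum `D : FiniteEpsData F G` (`D.fwd`, `D.curries`): `windowK_uniform_of_runConstRemainder` (+ `SatisfiesRG`) · `windowK_uniform_of_runConstRemainder_of_le`.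
* §3 θ-keyed at NODE 00's Stage-13 datum (general `N`; `(datum).βfun = betaOfRecord₁₃ θ`, def-T `rfl`): ★★ `windowK_uniform_datumOfRecord₁₃SepCoPH_of_runConstRemainder` · `…_of_le`;
  `N = 2`: `windowK_uniform_datumOfRecord₁₃SepCoPH_of_runRowsAt` (hypothesis = v6's stub-2″ rows ∃-bundle VERBATIM at `(θ, h, w)`; the bare coupling bounded by the WORLD's ceiling
  `g₀⁻² ≤ γ⁻² + K·max(w.βup, 0)`) · `windowK_uniform_of_runRowsAtSomeRecord13PWS` (the registered stub-2″ CONCLUSION `K1V6Defs.RunRowsAtSomeRecord13PWS F` BY NAME ⟹ at its witness runs of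
  every length in one window — MORE than the `K ≥ 1` window the skeleton derives from it).
* §4 ★ `bitesAllK_of_endStatementBPrinted_of_windowKUniform` (every `B16.Construction`) · ★★ `bitesAllK_datumOfRecord₁₃SepCoPH_of_endStatementBPrinted_of_runConstRemainder`.

HONEST SCOPE (A6, №189).  Elementary induction on (0.20) and bookkeeping; the run rows and (B) are DISPLAYED HYPOTHESES inhabited at NO θ here — row (i) is NODE O's analytic statement
([I] Thm 3 p. 264 with (1.20)–(1.22), (5.10) p. 293: β read along the runs `0 < g_k ≤ γ`) which the tree does not prove; nothing of Bałaban asserted; NOT a proof of `stub_runRows13PWS` or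
`stub_nodes13PWS`; K1⁷ ∕ K2⁷ NOT closed; N13 ∕ N24 NOT discharged; no stub closed; counts unmoved (typed 28∕28 · discharged 5∕27 · A 5∕28).  One finite four-torus programme at fixed
`ε = L^{−K}`, Bałaban AS PRINTED; the Yang–Mills mass gap (Clay) is NOT proved by any of this — route R4 closes the conditional finite-𝕋⁴ rung `BalabanLadder.UV` only; nothing continuum ∕
ℝ⁴ ∕ OS.  No `def`, no `instance`, no `notation`, no `axiom`.
References (context; nothing printed is used as a hypothesis): [I] = [Balaban1987RG1] CMP **109** (1987): (0.17)–(0.20) pp. 255–256, Thm 2 + (0.31) p. 259, (1.20)–(1.22) p. 264, Thm 3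
p. 264, (5.10) p. 293; [II] = [Balaban1988RG2Cluster] CMP **116** (1988): (2.41) p. 21; [III] = [Balaban1988Convergent] CMP **119** (1988): Cor. 3 (2.50) p. 264; [V] = [Balaban1989LargeFieldII]
CMP **122** (1989): Thm 1 + (0.1) pp. 355–356.
-/

noncomputable section

open scoped Matrix.Norms.L2Operator

namespace Summit.QuantumFields.YangMills.Theorems.BalabanUVNodesK1WindowKOfRunRows

open Literature.MathematicalPhysics.QuantumFieldTheory.Balaban1983to89
open Literature.MathematicalPhysics.QuantumFieldTheory.Balaban1983to89.FlowStep
open Literature.MathematicalPhysics.QuantumFieldTheory.Balaban1983to89.DagBinding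
open Literature.MathematicalPhysics.QuantumFieldTheory.Balaban1983to89.T4Continuum (T4Family FiniteEpsData)
open Literature.MathematicalPhysics.QuantumFieldTheory.Balaban1983to89.Node00
open Summit.QuantumFields.YangMills.Theorems.BalabanUVNodesK2NamedJetsRunRemAt (RunConstRemainder)

/-! ## §1. Flow side: the ladder from a run-wise per-level ceiling; runs of every length in one window from row (i) alone; explicit `g₀` under row (ii); the discrete face -/

section Flow

variable {β : HBeta}

/-- **ROW (i) READ AS A RUN-WISE PER-LEVEL CEILING**: DEF-1's `RunConstRemainder β b r γ₀` gives `β_{k+1}(g_0,…,g_k) ≤ b_k + r` at every prefix of every in-window (0.20)-run of level `γ₀`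
(its upper half; the lower half is unread by the window). [cite: Balaban1987RG1, Thm 3 p.264 and (1.20)–(1.22) p.264 (bookkeeping)] -/
theorem runwiseCeiling_of_runConstRemainder {b : ℕ → ℝ} {r γ₀ : ℝ} (hrem : RunConstRemainder β b r γ₀) :
    ∀ (n : ℕ) (gs : ℕ → ℝ), RGEqH n β gs → Step.InInterval γ₀ n gs → ∀ k, k ≤ n → β k (prefixOf gs k) ≤ b k + r := by
  intro n gs hrg hI k hk
  have h := (abs_le.mp (hrem n gs hrg hI k hk)).2
  linarith

/-- **THE DICTIONARY's CONVERSE** (of `DagBinding.rgEqH_of_curries`): if the run's one-variable β-functions curry `β` (`CurriesHBeta`), the HISTORY recursion `RGEqH K β g` up to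
`K ≤ P.K` for the run's couplings IS (0.20) in the `Flow.SatisfiesRG K` form (`β_{j+1}(g_j) = β j (g_0,…,g_j)` by `update_prefixOf_last`). [cite: Balaban1987RG1, (0.20) p.256 and §5 p.298 (bookkeeping)] -/
theorem satisfiesRG_of_curries_of_rgEqH (C : B12.Construction) (β : HBeta) (hcur : CurriesHBeta C β) (P : B12.RunParams) {K : ℕ} (hK : K ≤ P.K)
    (hrg : RGEqH K β (C P).flow.g) : (C P).flow.SatisfiesRG K := by
  intro k hk
  rw [hcur P k _ (lt_of_lt_of_le hk hK), update_prefixOf_last]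
  exact hrg k hk

/-- ★ **THE LADDER FROM A RUN-WISE PER-LEVEL CEILING** (forward-generated `C`).  Hypothesis `hup`: along every solution of (0.20) up to `n` staying in `]0, γ₀]`, `β k (g_0,…,g_k) ≤ u_k`
(`k ≤ n`) — row (i)'s shape with `u_k = b_k + r`.  For `0 < γ ≤ γ₀` and a bare coupling `g₀ > 0` with `γ⁻² + Σ_{k<K} max(u_k,0) ≤ g₀⁻²`: for every `k ≤ K` the run `⟨K, m, g₀⟩` SOLVES (0.20)
up to `k` (`RGEqH k β g`), its couplings `g_i`, `i ≤ k`, lie in `]0, γ]`, and `γ⁻² + Σ_{i≤j<K} max(u_j,0) ≤ g_i⁻²`.  Induction on `k`: the prefix generated so far IS an in-window run of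
level `γ₀`, so `hup` bounds `β k` AT IT; the right side of (0.20) stays `≥ γ⁻² > 0`, forward generation produces the next positive coupling and the next equation.  No box letter, no
continuity, no sign. [cite: Balaban1987RG1, (0.17)–(0.20) pp.255–256 and Thm 3 p.264 (elementary consequence)] -/
theorem ladder_of_forwardGenerated_of_runwiseCeiling (C : B12.Construction) (β : HBeta) (hgen : ForwardGenerated C β) {u : ℕ → ℝ} {γ₀ γ g₀ : ℝ}
    (hup : ∀ (n : ℕ) (gs : ℕ → ℝ), RGEqH n β gs → Step.InInterval γ₀ n gs → ∀ k, k ≤ n → β k (prefixOf gs k) ≤ u k)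
    (hγ : 0 < γ) (hγ₀ : γ ≤ γ₀) (hg₀ : 0 < g₀) (m K : ℕ) (hstart : 1 / γ ^ 2 + ∑ k ∈ Finset.range K, max (u k) 0 ≤ 1 / g₀ ^ 2) :
    ∀ k, k ≤ K → RGEqH k β (C ⟨K, m, g₀⟩).flow.g ∧ ∀ i, i ≤ k →
      (0 < (C ⟨K, m, g₀⟩).flow.g i ∧ (C ⟨K, m, g₀⟩).flow.g i ≤ γ) ∧
        1 / γ ^ 2 + ∑ j ∈ Finset.Ico i K, max (u j) 0 ≤ 1 / ((C ⟨K, m, g₀⟩).flow.g i) ^ 2 := by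
  set P : B12.RunParams := ⟨K, m, g₀⟩ with hPdef
  have hg0 : (C P).flow.g 0 = g₀ := hgen.1 P
  have hγ2 : 0 < 1 / γ ^ 2 := by positivity
  have hS0 : ∀ i, 0 ≤ ∑ j ∈ Finset.Ico i K, max (u j) 0 := fun i => Finset.sum_nonneg fun j _ => le_max_right _ _
  have hSstep : ∀ i, i < K → ∑ j ∈ Finset.Ico i K, max (u j) 0 = max (u i) 0 + ∑ j ∈ Finset.Ico (i + 1) K, max (u j) 0 :=
    fun i hi => Finset.sum_eq_sum_Ico_succ_bot hi _
  -- from the ladder bound at `i`, the coupling is `≤ γ`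
  have hleγ : ∀ x : ℝ, 0 < x → ∀ i, 1 / γ ^ 2 + ∑ j ∈ Finset.Ico i K, max (u j) 0 ≤ 1 / x ^ 2 → x ≤ γ := by
    intro x hx i hb
    have hle : 1 / γ ^ 2 ≤ 1 / x ^ 2 := le_trans (le_add_of_nonneg_right (hS0 i)) hb
    have h2 : x ^ 2 ≤ γ ^ 2 := (one_div_le_one_div (pow_pos hγ 2) (pow_pos hx 2)).1 hle
    nlinarith [h2, hx, hγ]
  intro k
  induction k with
  | zero =>
    intro _
    refine ⟨fun j hj => absurd hj (Nat.not_lt_zero j), fun i hi => ?_⟩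
    obtain rfl : i = 0 := Nat.le_zero.mp hi
    have hst : 1 / γ ^ 2 + ∑ j ∈ Finset.Ico 0 K, max (u j) 0 ≤ 1 / g₀ ^ 2 := by rwa [← Finset.range_eq_Ico]
    rw [hg0]
    exact ⟨⟨hg₀, hleγ g₀ hg₀ 0 hst⟩, hst⟩
  | succ k ih =>
    intro hk
    have hkK : k < K := Nat.lt_of_succ_le hk
    obtain ⟨hrg, hb⟩ := ih hkK.le
    have hpos : ∀ j, j ≤ k → 0 < (C P).flow.g j := fun j hj => (hb j hj).1.1
    -- the prefix up to `k` is an in-window (0.20)-run of level `γ₀`; the ceiling applies AT it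
    have hI : Step.InInterval γ₀ k (C P).flow.g := fun j hj => ⟨(hb j hj).1.1, ((hb j hj).1.2).trans hγ₀⟩
    have hβle : β k (prefixOf (C P).flow.g k) ≤ max (u k) 0 := (hup k _ hrg hI k le_rfl).trans (le_max_left _ _)
    have hladk : 1 / γ ^ 2 + ∑ j ∈ Finset.Ico k K, max (u j) 0 ≤ 1 / ((C P).flow.g k) ^ 2 := (hb k le_rfl).2
    have hrhs_ge : 1 / γ ^ 2 + ∑ j ∈ Finset.Ico (k + 1) K, max (u j) 0 ≤ 1 / ((C P).flow.g k) ^ 2 - β k (prefixOf (C P).flow.g k) := by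
      rw [hSstep k hkK] at hladk
      linarith
    have hrhs : 0 < 1 / ((C P).flow.g k) ^ 2 - β k (prefixOf (C P).flow.g k) :=
      lt_of_lt_of_le (lt_of_lt_of_le hγ2 (le_add_of_nonneg_right (hS0 (k + 1)))) hrhs_ge
    obtain ⟨hposk1, heq⟩ := hgen.2 P k hkK hpos hrhs
    refine ⟨fun j hj => ?_, fun i hi => ?_⟩
    · rcases Nat.lt_or_ge j k with hlt | hge
      · exact hrg j hlt
      · obtain rfl : j = k := le_antisymm (Nat.lt_succ_iff.mp hj) hge
        rw [heq]
        ring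
    · rcases Nat.lt_or_ge i (k + 1) with hlt | hge
      · exact hb i (Nat.lt_succ_iff.mp hlt)
      · obtain rfl : i = k + 1 := le_antisymm hi hge
        have hb1 : 1 / γ ^ 2 + ∑ j ∈ Finset.Ico (k + 1) K, max (u j) 0 ≤ 1 / ((C P).flow.g (k + 1)) ^ 2 := by
          rw [heq]; exact hrhs_ge
        exact ⟨⟨hposk1, hleγ _ hposk1 (k + 1) hb1⟩, hb1⟩

/-- ★★ **RUNS OF EVERY LENGTH INSIDE ONE WINDOW FROM A RUN-WISE PER-LEVEL CEILING** (forward-generated `C`): for EVERY `γ ∈ ]0, γ₀]`, every `K` and every `m` the bare coupling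
`g₀ := (γ⁻² + Σ_{k<K} max(u_k,0))^{−1∕2} ∈ ]0, γ]` runs `⟨K, m, g₀⟩` inside `]0, γ]` AND solves (0.20) up to `K`.  ONE window radius `γ₀` for all `K` — the `InInterval` half of [I] Thm 2
p. 259 without the endpoint. [cite: Balaban1987RG1, (0.17)–(0.20) pp.255–256, Thm 2 p.259 and Thm 3 p.264 (elementary consequence)] -/
theorem windowK_uniform_of_forwardGenerated_of_runwiseCeiling (C : B12.Construction) (β : HBeta) (hgen : ForwardGenerated C β) {u : ℕ → ℝ} {γ₀ : ℝ}
    (hup : ∀ (n : ℕ) (gs : ℕ → ℝ), RGEqH n β gs → Step.InInterval γ₀ n gs → ∀ k, k ≤ n → β k (prefixOf gs k) ≤ u k) :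
    ∀ γ : ℝ, 0 < γ → γ ≤ γ₀ → ∀ K m : ℕ, ∃ g0 : ℝ, (0 < g0 ∧ g0 ≤ γ) ∧
      (C ⟨K, m, g0⟩).flow.InInterval γ K ∧ RGEqH K β (C ⟨K, m, g0⟩).flow.g := by
  intro γ hγ hγ₀ K m
  have hS0 : 0 ≤ ∑ k ∈ Finset.range K, max (u k) 0 := Finset.sum_nonneg fun j _ => le_max_right _ _
  set A : ℝ := 1 / γ ^ 2 + ∑ k ∈ Finset.range K, max (u k) 0 with hA
  have hApos : 0 < A := add_pos_of_pos_of_nonneg (by positivity) hS0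
  set g0 : ℝ := 1 / Real.sqrt A with hg0def
  have hg0 : 0 < g0 := by positivity
  have hg0sq : 1 / g0 ^ 2 = A := by rw [hg0def, div_pow, one_pow, Real.sq_sqrt hApos.le, one_div_one_div]
  obtain ⟨hrg, hb⟩ := ladder_of_forwardGenerated_of_runwiseCeiling C β hgen hup hγ hγ₀ hg0 m K (by rw [hg0sq]) K le_rfl
  have e : (C ⟨K, m, g0⟩).flow.g 0 = g0 := hgen.1 _
  refine ⟨g0, ⟨hg0, ?_⟩, fun k hk => (hb k hk).1, hrg⟩
  have h := (hb 0 (Nat.zero_le _)).1.2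
  rwa [e] at h

/-- ★★ **K1⁷ v6's ROW (i) ALONE ⟹ RUNS OF EVERY LENGTH INSIDE ONE WINDOW** (forward-generated `C`; `b` ANY reference sequence, `r`, `γ₀` free): `RunConstRemainder β b r γ₀` ⟹ for every
`γ ∈ ]0, γ₀]`, `K`, `m` some `g₀ ∈ ]0, γ]` runs `⟨K, m, g₀⟩` inside `]0, γ]` and solves (0.20) up to `K`.  (p598782's road reads row (i) at level `0` only and gets `K ≥ 1`.)
[cite: Balaban1987RG1, (0.17)–(0.20) pp.255–256, Thm 2 p.259, Thm 3 p.264 and (5.10) p.293 (elementary consequence)] -/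
theorem windowK_uniform_of_forwardGenerated_of_runConstRemainder (C : B12.Construction) (β : HBeta) (hgen : ForwardGenerated C β) {b : ℕ → ℝ} {r γ₀ : ℝ}
    (hrem : RunConstRemainder β b r γ₀) :
    ∀ γ : ℝ, 0 < γ → γ ≤ γ₀ → ∀ K m : ℕ, ∃ g0 : ℝ, (0 < g0 ∧ g0 ≤ γ) ∧
      (C ⟨K, m, g0⟩).flow.InInterval γ K ∧ RGEqH K β (C ⟨K, m, g0⟩).flow.g :=
  windowK_uniform_of_forwardGenerated_of_runwiseCeiling C β hgen (runwiseCeiling_of_runConstRemainder hrem)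

/-- **IN `DagBinding.EndpointExistence`'s PREFIX SHAPE, WITHOUT THE ENDPOINT** (`0 < γ₀`): row (i) ⟹ `∀ m, ∃ γ₂ > 0, ∀ γ ∈ ]0, γ₂], ∀ K, ∃ g₀, (C ⟨K, m, g₀⟩).flow.InInterval γ K` with
`γ₂ := γ₀` (the endpoint clause `g_K = g` — the unprinted half of Thm 2, T09.F — is what this does NOT give). [cite: Balaban1987RG1, Thm 2 p.259 (first sentence) (bookkeeping)] -/
theorem inIntervalHalf_of_forwardGenerated_of_runConstRemainder (C : B12.Construction) (β : HBeta) (hgen : ForwardGenerated C β) {b : ℕ → ℝ} {r γ₀ : ℝ} (hγ₀ : 0 < γ₀)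
    (hrem : RunConstRemainder β b r γ₀) :
    ∀ m : ℕ, ∃ γ₂ : ℝ, 0 < γ₂ ∧ ∀ γ : ℝ, 0 < γ → γ ≤ γ₂ → ∀ K : ℕ, ∃ g0 : ℝ, (C ⟨K, m, g0⟩).flow.InInterval γ K := by
  intro m
  refine ⟨γ₀, hγ₀, fun γ hγ hγle K => ?_⟩
  obtain ⟨g0, -, hI, -⟩ := windowK_uniform_of_forwardGenerated_of_runConstRemainder C β hgen hrem γ hγ hγle K m
  exact ⟨g0, hI⟩

/-- **ROWS (i)(ii): THE LINEAR LADDER WITH AN EXPLICIT BARE COUPLING** (forward-generated `C`): `RunConstRemainder β b r γ₀`, `b_k ≤ B`, `0 < γ ≤ γ₀`, `g₀ > 0` with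
`γ⁻² + K·max(B + r, 0) ≤ g₀⁻²` ⟹ for every `k ≤ K`: (0.20) up to `k` along `⟨K, m, g₀⟩`, couplings in `]0, γ]`, and `γ⁻² + (K − i)·max(B + r, 0) ≤ g_i⁻²` (`i ≤ k`).
[cite: Balaban1987RG1, (0.17)–(0.20) pp.255–256, (1.20)–(1.22) p.264 and Thm 3 p.264 (elementary consequence)] -/
theorem ladder_of_forwardGenerated_of_runConstRemainder_of_le (C : B12.Construction) (β : HBeta) (hgen : ForwardGenerated C β) {b : ℕ → ℝ} {r γ₀ B γ g₀ : ℝ}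
    (hrem : RunConstRemainder β b r γ₀) (hB : ∀ k, b k ≤ B) (hγ : 0 < γ) (hγ₀ : γ ≤ γ₀) (hg₀ : 0 < g₀) (m K : ℕ)
    (hstart : 1 / γ ^ 2 + (K : ℝ) * max (B + r) 0 ≤ 1 / g₀ ^ 2) :
    ∀ k, k ≤ K → RGEqH k β (C ⟨K, m, g₀⟩).flow.g ∧ ∀ i, i ≤ k →
      (0 < (C ⟨K, m, g₀⟩).flow.g i ∧ (C ⟨K, m, g₀⟩).flow.g i ≤ γ) ∧
        1 / γ ^ 2 + ((K : ℝ) - i) * max (B + r) 0 ≤ 1 / ((C ⟨K, m, g₀⟩).flow.g i) ^ 2 := by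
  have hup : ∀ (n : ℕ) (gs : ℕ → ℝ), RGEqH n β gs → Step.InInterval γ₀ n gs → ∀ k, k ≤ n → β k (prefixOf gs k) ≤ B + r :=
    fun n gs hrg hI k hk => (runwiseCeiling_of_runConstRemainder hrem n gs hrg hI k hk).trans (by linarith [hB k])
  have hstart' : 1 / γ ^ 2 + ∑ _k ∈ Finset.range K, max (B + r) 0 ≤ 1 / g₀ ^ 2 := by
    rw [Finset.sum_const, Finset.card_range, nsmul_eq_mul]
    exact hstart
  intro k hk
  obtain ⟨hrg, hb⟩ := ladder_of_forwardGenerated_of_runwiseCeiling C β hgen (u := fun _ => B + r) hup hγ hγ₀ hg₀ m K hstart' k hk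
  refine ⟨hrg, fun i hi => ⟨(hb i hi).1, ?_⟩⟩
  have h := (hb i hi).2
  rwa [Finset.sum_const, Nat.card_Ico, nsmul_eq_mul, Nat.cast_sub (hi.trans hk)] at h

/-- **ROWS (i)(ii) ⟹ RUNS OF EVERY LENGTH INSIDE ONE WINDOW WITH THE EXPLICIT BARE COUPLING `g₀⁻² = γ⁻² + K·max(B + r, 0)`** (forward-generated `C`; every `γ ∈ ]0, γ₀]`, `K`, `m`):
the run `⟨K, m, g₀⟩` lies in `]0, γ]`, solves (0.20) up to `K`, and climbs the linear ladder `γ⁻² + (K − i)·max(B + r, 0) ≤ g_i⁻²`.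
[cite: Balaban1987RG1, (0.17)–(0.20) pp.255–256, Thm 2 p.259, (1.20)–(1.22) p.264 and Thm 3 p.264 (elementary consequence)] -/
theorem windowK_uniform_of_forwardGenerated_of_runConstRemainder_of_le (C : B12.Construction) (β : HBeta) (hgen : ForwardGenerated C β) {b : ℕ → ℝ} {r γ₀ B : ℝ}
    (hrem : RunConstRemainder β b r γ₀) (hB : ∀ k, b k ≤ B) {γ : ℝ} (hγ : 0 < γ) (hγ₀ : γ ≤ γ₀) (K m : ℕ) :
    ∃ g0 : ℝ, 1 / g0 ^ 2 = 1 / γ ^ 2 + (K : ℝ) * max (B + r) 0 ∧ (0 < g0 ∧ g0 ≤ γ) ∧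
      (C ⟨K, m, g0⟩).flow.InInterval γ K ∧ RGEqH K β (C ⟨K, m, g0⟩).flow.g ∧
        ∀ i, i ≤ K → 1 / γ ^ 2 + ((K : ℝ) - i) * max (B + r) 0 ≤ 1 / ((C ⟨K, m, g0⟩).flow.g i) ^ 2 := by
  set A : ℝ := 1 / γ ^ 2 + (K : ℝ) * max (B + r) 0 with hA
  have hApos : 0 < A := add_pos_of_pos_of_nonneg (by positivity) (mul_nonneg (Nat.cast_nonneg K) (le_max_right _ _))
  set g0 : ℝ := 1 / Real.sqrt A with hg0def
  have hg0 : 0 < g0 := by positivity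
  have hg0sq : 1 / g0 ^ 2 = A := by rw [hg0def, div_pow, one_pow, Real.sq_sqrt hApos.le, one_div_one_div]
  obtain ⟨hrg, hb⟩ := ladder_of_forwardGenerated_of_runConstRemainder_of_le C β hgen hrem hB hγ hγ₀ hg0 m K (by rw [hg0sq]) K le_rfl
  have e : (C ⟨K, m, g0⟩).flow.g 0 = g0 := hgen.1 _
  refine ⟨g0, hg0sq, ⟨hg0, ?_⟩, fun k hk => (hb k hk).1, hrg, fun i hi => (hb i hi).2⟩
  have h := (hb 0 (Nat.zero_le _)).1.2
  rwa [e] at h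

/-- **ROWS (i)(ii)(iv) ⟹ THE TWO-SIDED DISCRETE FACE ALONG EVERY IN-WINDOW RUN** (any `β`; no construction): along every solution of (0.20) up to `n` staying in `]0, γ₀]` and all
`i ≤ k ≤ n`: `g_i⁻² − (k − i)(B + r) ≤ g_k⁻² ≤ g_i⁻² + M` — telescoped (0.20) (`FlowStep.inv_sq_telescopeH`) with the ceiling `β_j ≤ b_j + r ≤ B + r` (rows (i)(ii)) and the partial-sum
floor `Σ_{j∈[i,k)} β_j ≥ −M` (row (iv) at the shorter run `k ≤ n`).  The rows' (0.31)-type content, keyed at the EARLIER coupling. [cite: Balaban1987RG1, (0.20) p.256, Thm 2 (0.31) p.259 and Thm 3 p.264; Balaban1988RG2Cluster, (2.41) p.21 (elementary consequence)] -/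
theorem discreteFace_alongRun_of_runRows {b : ℕ → ℝ} {r γ₀ B M : ℝ} (hrem : RunConstRemainder β b r γ₀) (hB : ∀ k, b k ≤ B)
    (hps : ∀ (n : ℕ) (gs : ℕ → ℝ), RGEqH n β gs → Step.InInterval γ₀ n gs → ∀ k, k ≤ n → -M ≤ ∑ j ∈ Finset.Ico k n, β j (prefixOf gs j))
    {n : ℕ} {gs : ℕ → ℝ} (hrg : RGEqH n β gs) (hI : Step.InInterval γ₀ n gs) {i k : ℕ} (hik : i ≤ k) (hkn : k ≤ n) :
    1 / (gs i) ^ 2 - ((k : ℝ) - i) * (B + r) ≤ 1 / (gs k) ^ 2 ∧ 1 / (gs k) ^ 2 ≤ 1 / (gs i) ^ 2 + M := by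
  have ht := inv_sq_telescopeH hrg hik hkn
  have hup : ∑ j ∈ Finset.Ico i k, β j (prefixOf gs j) ≤ ((k : ℝ) - i) * (B + r) := by
    have hcard : ((Finset.Ico i k).card : ℝ) = (k : ℝ) - i := by rw [Nat.card_Ico, Nat.cast_sub hik]
    have h := Finset.sum_le_card_nsmul (Finset.Ico i k) (fun j => β j (prefixOf gs j)) (B + r) fun j hj =>
      (runwiseCeiling_of_runConstRemainder hrem n gs hrg hI j ((Finset.mem_Ico.mp hj).2.le.trans hkn)).trans (by linarith [hB j])
    rw [nsmul_eq_mul, hcard] at h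
    linarith
  have hlo : -M ≤ ∑ j ∈ Finset.Ico i k, β j (prefixOf gs j) :=
    hps k gs (fun j hj => hrg j (lt_of_lt_of_le hj hkn)) (fun j hj => hI j (hj.trans hkn)) i hik
  constructor <;> linarith

end Flow

/-! ## §2. At every finite-ε datum `D` (`D.fwd`, `D.curries`): runs of every length in one window, solving (0.20) in the `Flow.SatisfiesRG` form -/

section Datum

variable {F : T4Family} {G : Type*} [GaugeGroup G] [MeasurableSpace G] [HaarData G]

/-- **AT ANY FINITE-ε DATUM, ROW (i) ALONE ⟹ RUNS OF EVERY LENGTH INSIDE ONE WINDOW, SOLVING (0.20)** (`D.βfun` currency; `D.fwd` generates, `D.curries` converts `RGEqH` into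
`Flow.SatisfiesRG`). [cite: Balaban1987RG1, (0.17)–(0.20) pp.255–256, Thm 2 p.259 and Thm 3 p.264 (elementary consequence)] -/
theorem windowK_uniform_of_runConstRemainder (D : FiniteEpsData F G) {b : ℕ → ℝ} {r γ₀ : ℝ} (hrem : RunConstRemainder D.βfun b r γ₀) :
    ∀ γ : ℝ, 0 < γ → γ ≤ γ₀ → ∀ K m : ℕ, ∃ g0 : ℝ, (0 < g0 ∧ g0 ≤ γ) ∧
      (D.C ⟨K, m, g0⟩).flow.InInterval γ K ∧ (D.C ⟨K, m, g0⟩).flow.SatisfiesRG K := by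
  intro γ hγ hγ₀ K m
  obtain ⟨g0, hg0, hI, hrg⟩ := windowK_uniform_of_forwardGenerated_of_runConstRemainder D.C.toB12 D.βfun D.fwd hrem γ hγ hγ₀ K m
  exact ⟨g0, hg0, hI, satisfiesRG_of_curries_of_rgEqH D.C.toB12 D.βfun D.curries ⟨K, m, g0⟩ le_rfl hrg⟩

/-- **… and with row (ii): the explicit bare coupling `g₀⁻² = γ⁻² + K·max(B + r, 0)` and the linear ladder.** [cite: Balaban1987RG1, (0.17)–(0.20) pp.255–256, (1.20)–(1.22) p.264 and Thm 2 p.259 (elementary consequence)] -/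
theorem windowK_uniform_of_runConstRemainder_of_le (D : FiniteEpsData F G) {b : ℕ → ℝ} {r γ₀ B : ℝ} (hrem : RunConstRemainder D.βfun b r γ₀) (hB : ∀ k, b k ≤ B)
    {γ : ℝ} (hγ : 0 < γ) (hγ₀ : γ ≤ γ₀) (K m : ℕ) :
    ∃ g0 : ℝ, 1 / g0 ^ 2 = 1 / γ ^ 2 + (K : ℝ) * max (B + r) 0 ∧ (0 < g0 ∧ g0 ≤ γ) ∧
      (D.C ⟨K, m, g0⟩).flow.InInterval γ K ∧ (D.C ⟨K, m, g0⟩).flow.SatisfiesRG K ∧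
        ∀ i, i ≤ K → 1 / γ ^ 2 + ((K : ℝ) - i) * max (B + r) 0 ≤ 1 / ((D.C ⟨K, m, g0⟩).flow.g i) ^ 2 := by
  obtain ⟨g0, hsq, hg0, hI, hrg, hlad⟩ := windowK_uniform_of_forwardGenerated_of_runConstRemainder_of_le D.C.toB12 D.βfun D.fwd hrem hB hγ hγ₀ K m
  exact ⟨g0, hsq, hg0, hI, satisfiesRG_of_curries_of_rgEqH D.C.toB12 D.βfun D.curries ⟨K, m, g0⟩ le_rfl hrg, hlad⟩

end Datum

/-! ## §3. θ-keyed at NODE 00's Stage-13 datum `datumOfRecord₁₃SepCoPH F N θ h` (`(datum).βfun = betaOfRecord₁₃ θ`, def-T `rfl`); v6's rows text at `(θ, h, w)`; the stub-2″ conclusion by name -/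

section Record

variable {F : T4Family} {N : ℕ} [NeZero N]

/-- ★★ **AT THE STAGE-13 DATUM, ROW (i) ALONE ⟹ RUNS OF EVERY LENGTH INSIDE ONE WINDOW** (general `N`; every proviso witness `h`): `RunConstRemainder (betaOfRecord₁₃ F N θ) b r γ₀` ⟹
for every `γ ∈ ]0, γ₀]`, `K`, `m` some `g₀ ∈ ]0, γ]` with `((datumOfRecord₁₃SepCoPH F N θ h).C ⟨K, m, g₀⟩).flow.InInterval γ K` AND (0.20) up to `K` along it.  DISPLAYED hypothesis (NODE O's);
NOT a proof of `stub_runRows13PWS`. [cite: Balaban1987RG1, (0.17)–(0.20) pp.255–256, Thm 2 p.259, (1.20)–(1.22) p.264, Thm 3 p.264, (5.10) p.293; Balaban1989LargeFieldII, Thm 1 + (0.1) pp.355–356 (bookkeeping + elementary)] -/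
theorem windowK_uniform_datumOfRecord₁₃SepCoPH_of_runConstRemainder (θ : Stage13HParams F N) (h : θ.Provisos₁₃SepCoPH F N) {b : ℕ → ℝ} {r γ₀ : ℝ}
    (hrem : RunConstRemainder (betaOfRecord₁₃ F N θ.toStage13Params) b r γ₀) :
    ∀ γ : ℝ, 0 < γ → γ ≤ γ₀ → ∀ K m : ℕ, ∃ g0 : ℝ, (0 < g0 ∧ g0 ≤ γ) ∧
      ((datumOfRecord₁₃SepCoPH F N θ h).C ⟨K, m, g0⟩).flow.InInterval γ K ∧ ((datumOfRecord₁₃SepCoPH F N θ h).C ⟨K, m, g0⟩).flow.SatisfiesRG K :=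
  windowK_uniform_of_runConstRemainder (datumOfRecord₁₃SepCoPH F N θ h) hrem

/-- **… and with row (ii) at the datum: explicit `g₀⁻² = γ⁻² + K·max(B + r, 0)`, linear ladder along `gOfRecord₁₃ θ ⟨K, m, g₀⟩`.**
[cite: Balaban1987RG1, (0.17)–(0.20) pp.255–256, (1.20)–(1.22) p.264 and Thm 2 p.259; Balaban1989LargeFieldII, Thm 1 p.355 (bookkeeping + elementary)] -/
theorem windowK_uniform_datumOfRecord₁₃SepCoPH_of_runConstRemainder_of_le (θ : Stage13HParams F N) (h : θ.Provisos₁₃SepCoPH F N) {b : ℕ → ℝ} {r γ₀ B : ℝ}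
    (hrem : RunConstRemainder (betaOfRecord₁₃ F N θ.toStage13Params) b r γ₀) (hB : ∀ k, b k ≤ B) {γ : ℝ} (hγ : 0 < γ) (hγ₀ : γ ≤ γ₀) (K m : ℕ) :
    ∃ g0 : ℝ, 1 / g0 ^ 2 = 1 / γ ^ 2 + (K : ℝ) * max (B + r) 0 ∧ (0 < g0 ∧ g0 ≤ γ) ∧
      ((datumOfRecord₁₃SepCoPH F N θ h).C ⟨K, m, g0⟩).flow.InInterval γ K ∧ ((datumOfRecord₁₃SepCoPH F N θ h).C ⟨K, m, g0⟩).flow.SatisfiesRG K ∧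
        ∀ i, i ≤ K → 1 / γ ^ 2 + ((K : ℝ) - i) * max (B + r) 0 ≤ 1 / (gOfRecord₁₃ F N θ.toStage13Params ⟨K, m, g0⟩ i) ^ 2 :=
  windowK_uniform_of_runConstRemainder_of_le (datumOfRecord₁₃SepCoPH F N θ h) hrem hB hγ hγ₀ K m

variable {F : T4Family} in
/-- **`N = 2`: K1⁷ v6's STUB-2″ ROWS TEXT AT `(θ, h, w)` ⟹ RUNS OF EVERY LENGTH INSIDE ONE WINDOW AT THE DATUM** — hypothesis = the rows ∃-bundle of `RunRowsAtSomeRecord13PWS` VERBATIM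
(`b r γ₀ B M` ∃-side); only rows (i)(ii)(iii) are read: the window radius is row (i)'s level `γ₀`, and by the match (iii) the bare coupling is bounded by the WORLD's ceiling alone,
`g₀⁻² ≤ γ⁻² + K·max(w.βup, 0)`.  CONDITIONAL; NOT a proof of `stub_runRows13PWS`. [cite: Balaban1987RG1, (0.17)–(0.20) pp.255–256, Thm 2 p.259, Thm 3 p.264, (5.10) p.293; Balaban1989LargeFieldII, Thm 1 p.355 (bookkeeping + elementary)] -/
theorem windowK_uniform_datumOfRecord₁₃SepCoPH_of_runRowsAt (θ : Stage13HParams F 2) (h : θ.Provisos₁₃SepCoPH F 2) (w : WorldP)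
    (hrows : ∃ (b : ℕ → ℝ) (r γ₀ B M : ℝ), 0 < γ₀ ∧ RunConstRemainder (betaOfRecord₁₃ F 2 θ.toStage13Params) b r γ₀ ∧ (∀ k, b k ≤ B) ∧ B + r ≤ w.βup ∧
      ∀ (n : ℕ) (gs : ℕ → ℝ), RGEqH n (betaOfRecord₁₃ F 2 θ.toStage13Params) gs → Step.InInterval γ₀ n gs →
        ∀ k, k ≤ n → -M ≤ ∑ j ∈ Finset.Ico k n, betaOfRecord₁₃ F 2 θ.toStage13Params j (prefixOf gs j)) :
    ∃ γ₀ : ℝ, 0 < γ₀ ∧ ∀ γ : ℝ, 0 < γ → γ ≤ γ₀ → ∀ K m : ℕ, ∃ g0 : ℝ, (0 < g0 ∧ g0 ≤ γ) ∧ 1 / g0 ^ 2 ≤ 1 / γ ^ 2 + (K : ℝ) * max w.βup 0 ∧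
      ((datumOfRecord₁₃SepCoPH F 2 θ h).C ⟨K, m, g0⟩).flow.InInterval γ K ∧ ((datumOfRecord₁₃SepCoPH F 2 θ h).C ⟨K, m, g0⟩).flow.SatisfiesRG K := by
  obtain ⟨b, r, γ₀, B, M, hγ₀, hrem, hB, hmatch, -⟩ := hrows
  refine ⟨γ₀, hγ₀, fun γ hγ hγle K m => ?_⟩
  obtain ⟨g0, hsq, hg0, hI, hrg, -⟩ := windowK_uniform_datumOfRecord₁₃SepCoPH_of_runConstRemainder_of_le θ h hrem hB hγ hγle K m
  refine ⟨g0, hg0, ?_, hI, hrg⟩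
  rw [hsq]
  have hmax : max (B + r) 0 ≤ max w.βup 0 := max_le_max hmatch le_rfl
  have hK : (0 : ℝ) ≤ K := Nat.cast_nonneg K
  nlinarith [mul_le_mul_of_nonneg_left hmax hK]

/-- **THE REGISTERED STUB-2″ CONCLUSION BY NAME ⟹ RUNS OF EVERY LENGTH INSIDE ONE WINDOW AT ITS WITNESS**: `K1V6Defs.RunRowsAtSomeRecord13PWS F` (dag-n24-w1's tree mirror of v6's text)
⟹ some unity admissible `(θ, h)` at whose datum, on some `]0, γ₀]`, every `γ` and EVERY `K`, `m` carry a run `⟨K, m, g₀⟩` in `]0, γ]` solving (0.20) — MORE than the crux's `K ≥ 1` window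
conjunct that the skeleton's composition derives from the same text.  CONDITIONAL on the text; K1⁷ NOT closed; nothing of Bałaban asserted.
[cite: Balaban1987RG1, (0.17)–(0.20) pp.255–256, Thm 2 p.259, Thm 3 p.264; Balaban1989LargeFieldII, Thm 1 + (0.1) pp.355–356 (bookkeeping)] -/
theorem windowK_uniform_of_runRowsAtSomeRecord13PWS (F : T4Family) (hrows : K1V6Defs.RunRowsAtSomeRecord13PWS F) :
    ∃ (θ : Stage13HParams F 2) (h : θ.Provisos₁₃SepCoPH F 2), (θ.ZhUnity F 2 ∧ θ.SlotsNondegenerate₁₃ F 2) ∧ θ.Admissible F 2 ∧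
      ∃ γ₀ : ℝ, 0 < γ₀ ∧ ∀ γ : ℝ, 0 < γ → γ ≤ γ₀ → ∀ K m : ℕ, ∃ g0 : ℝ, (0 < g0 ∧ g0 ≤ γ) ∧
        ((datumOfRecord₁₃SepCoPH F 2 θ h).C ⟨K, m, g0⟩).flow.InInterval γ K ∧ ((datumOfRecord₁₃SepCoPH F 2 θ h).C ⟨K, m, g0⟩).flow.SatisfiesRG K := by
  obtain ⟨θ, h, w, hU, hθ, -, -, b, r, γ₀, B, M, hγ₀, hrem, -, -, -⟩ := hrows
  exact ⟨θ, h, hU, hθ, γ₀, hγ₀, windowK_uniform_datumOfRecord₁₃SepCoPH_of_runConstRemainder θ h hrem⟩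

end Record

/-! ## §4. (B) bites at EVERY level on runs of EVERY length inside ONE window -/

section BiteAllK

/-- ★ **UNDER A K-UNIFORM WINDOW, (B) BITES AT EVERY LEVEL ON RUNS OF EVERY LENGTH INSIDE ONE WINDOW** (every `C : B16.Construction`): [V]'s end statement (B) as printed
(`Thm1Printed ∧ Cor3_250`, each with its own `γ`) + «on some `]0, γ_u]`: every `γ`, `K`, `m` carry a run `⟨K, m, g₀⟩` in `]0, γ]`» ⟹ level-independent `e_±` and ONE `γ_B > 0` such that for
every `γ ∈ ]0, γ_B]`, every `K` and `m` some run of length EXACTLY `K` lies in `]0, γ]`, carries `Sect2Form k` at every `k ≤ K`, and (2.50) at every `k ≤ K` and every configuration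
(`γ_B := min γ_u (min γ_T γ_C)`).  The uniform twin of g2's `…K1WindowKOfAnchor.bitesK_of_endStatementBPrinted_of_windowK` (one window per `K` there).
[cite: Balaban1989LargeFieldII, Thm 1 + (0.1) pp.355–356; Balaban1988Convergent, Cor. 3 (2.50) p.264 (bookkeeping)] -/
theorem bitesAllK_of_endStatementBPrinted_of_windowKUniform (C : B16.Construction) (hB : B16.EndStatementBPrinted C)
    (hKu : ∃ γu : ℝ, 0 < γu ∧ ∀ γ : ℝ, 0 < γ → γ ≤ γu → ∀ K m : ℕ, ∃ g0 : ℝ, 0 < g0 ∧ (C ⟨K, m, g0⟩).flow.InInterval γ K) :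
    ∃ em ep : ℝ → ℝ, ∃ γB : ℝ, 0 < γB ∧ ∀ γ : ℝ, 0 < γ → γ ≤ γB → ∀ K m : ℕ, ∃ g0 : ℝ, 0 < g0 ∧ (C ⟨K, m, g0⟩).flow.InInterval γ K ∧
      (∀ k, k ≤ K → (C ⟨K, m, g0⟩).Sect2Form k) ∧
        ∀ k, k ≤ K → ∀ V : (C ⟨K, m, g0⟩).Cfg k,
          B16.UVIneq (C ⟨K, m, g0⟩) k V (em ((C ⟨K, m, g0⟩).flow.g k)) (ep ((C ⟨K, m, g0⟩).flow.g k)) := by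
  obtain ⟨⟨γT, hγT, hT⟩, ⟨γC, hγC, em, ep, hC⟩⟩ := hB
  obtain ⟨γu, hγu, hrun⟩ := hKu
  refine ⟨em, ep, min γu (min γT γC), lt_min hγu (lt_min hγT hγC), fun γ hγ hγle K m => ?_⟩
  obtain ⟨g0, hg0, hI⟩ := hrun γ hγ (hγle.trans (min_le_left _ _)) K m
  have hIT : (C ⟨K, m, g0⟩).flow.InInterval γT K :=
    B14Cor3.inInterval_of_le hI (hγle.trans ((min_le_right _ _).trans (min_le_left _ _)))
  have hIC : (C ⟨K, m, g0⟩).flow.InInterval γC K :=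
    B14Cor3.inInterval_of_le hI (hγle.trans ((min_le_right _ _).trans (min_le_right _ _)))
  exact ⟨g0, hg0, hI, hT ⟨K, m, g0⟩ hIT, hC ⟨K, m, g0⟩ hIC⟩

variable {F : T4Family} {N : ℕ} [NeZero N] in
/-- ★★ **AT THE STAGE-13 DATUM, (B) ∧ ROW (i) ⟹ (B) BITES AT EVERY LEVEL ON RUNS OF EVERY LENGTH INSIDE ONE WINDOW** (general `N`, `0 < γ₀`): [V]'s (B) at `(datumOfRecord₁₃SepCoPH F N θ h).C`
and `RunConstRemainder (betaOfRecord₁₃ θ) b r γ₀` (both DISPLAYED, not discharged) give level-independent `e_±` and ONE `γ_B > 0` in each of whose `γ`, for every `K`, `m`, some run of length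
EXACTLY `K` carries §2's description and (2.50) at EVERY level `k ≤ K` — no level of (B) is vacuous and no length needs its own window.  CONDITIONAL; K1⁷ NOT closed; N13 NOT discharged.
[cite: Balaban1989LargeFieldII, Thm 1 + (0.1) pp.355–356; Balaban1988Convergent, Cor. 3 (2.50) p.264; Balaban1987RG1, Thm 2 p.259 and Thm 3 p.264 (bookkeeping)] -/
theorem bitesAllK_datumOfRecord₁₃SepCoPH_of_endStatementBPrinted_of_runConstRemainder (θ : Stage13HParams F N) (h : θ.Provisos₁₃SepCoPH F N)
    (hB : B16.EndStatementBPrinted (datumOfRecord₁₃SepCoPH F N θ h).C) {b : ℕ → ℝ} {r γ₀ : ℝ} (hγ₀ : 0 < γ₀)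
    (hrem : RunConstRemainder (betaOfRecord₁₃ F N θ.toStage13Params) b r γ₀) :
    ∃ em ep : ℝ → ℝ, ∃ γB : ℝ, 0 < γB ∧ ∀ γ : ℝ, 0 < γ → γ ≤ γB → ∀ K m : ℕ, ∃ g0 : ℝ, 0 < g0 ∧
      ((datumOfRecord₁₃SepCoPH F N θ h).C ⟨K, m, g0⟩).flow.InInterval γ K ∧
        (∀ k, k ≤ K → ((datumOfRecord₁₃SepCoPH F N θ h).C ⟨K, m, g0⟩).Sect2Form k) ∧
          ∀ k, k ≤ K → ∀ V : ((datumOfRecord₁₃SepCoPH F N θ h).C ⟨K, m, g0⟩).Cfg k,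
            B16.UVIneq ((datumOfRecord₁₃SepCoPH F N θ h).C ⟨K, m, g0⟩) k V
              (em (((datumOfRecord₁₃SepCoPH F N θ h).C ⟨K, m, g0⟩).flow.g k)) (ep (((datumOfRecord₁₃SepCoPH F N θ h).C ⟨K, m, g0⟩).flow.g k)) := by
  refine bitesAllK_of_endStatementBPrinted_of_windowKUniform _ hB ⟨γ₀, hγ₀, fun γ hγ hγle K m => ?_⟩
  obtain ⟨g0, hg0, hI, -⟩ := windowK_uniform_datumOfRecord₁₃SepCoPH_of_runConstRemainder θ h hrem γ hγ hγle K m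
  exact ⟨g0, hg0.1, hI⟩

end BiteAllK

end Summit.QuantumFields.YangMills.Theorems.BalabanUVNodesK1WindowKOfRunRows

end
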